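/-
COR-CM (cell pub-hodgecm2, stage 2 of the Hodge ladder) — count-neutral kernel combinatorics (seat prover-pub-hodgecm2-b23-g51-0, binder
prover b23, gen 51; lane SYLOW TRANSFER, claim HOME/INBOX.md l.23329).  Theorems only, in seat b09's intrinsic model (`CMF G c`, `gfaceSet`,
`pairSet`, `translates`, `hodgeSpan`, `Block`, `fibreTwo` — consumed BY NAME, nothing restated) plus Mathlib's Burnside transfer
(`MonoidHom.transferSylow`, `IsCyclic.normalizer_le_centralizer`); no definition, no certificate, no `decide`, no named fact, no geometry,
no `sorry`.  `Interfaces.lean` (C1), every E term, B01 and `Transposition/*` are untouched.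
HONEST FRAMING: `HC_CM` is NOT proved, here or anywhere in the tree; nothing here is a period or a headline.
-/
import Summits.HodgeConjecture.CorCM.Census.CyclicCharacterCyclicSylowLaw
import Summits.HodgeConjecture.CorCM.Census.TypeStabiliserSylow
import Mathlib.GroupTheory.Transfer

/-!
# Sylow transfer, II: cyclic Sylow `2`-subgroups — seat b09's CYCLIC-SYLOW LAW with its datum discharged

Seat b09's CYCLIC-SYLOW LAW (`Census/CyclicCharacterCyclicSylowLaw.lean`, `CyclicCharacter.isLeast_card_gfaces_generate_of_cyclic`) reads:
for an additive `w : G ↠ ℤ/2ᵏ` (`k ≥ 2`) with `w c ≠ 0` whose kernel is non-trivial and consists of odd-order elements,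
`μ(G, c) = φ₂(G, c)` and `φ₂ + 1 = β`.  THIS FILE constructs that datum from the bare hypothesis **«a Sylow `2`-subgroup of `G` is cyclic»**
(of order `2ᵏ ≥ 4`, and `G` is not a `2`-group):
* §1 `N_G(P)/C_G(P)` is an odd-order subgroup of the `2`-group `Aut(ℤ/2ᵏ)`, so `N_G(P) ≤ C_G(P)` (Mathlib `IsCyclic.normalizer_le_centralizer`,
  smallest prime `2`) and BURNSIDE'S TRANSFER `V : G →* P` has a normal complement `N = ker V` of odd order `[G:P]`
  (`MonoidHom.ker_transferSylow_isComplement'`, `not_dvd_card_ker_transferSylow`), `V|_P = (g ↦ g^{[G:P]})` a bijection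
  (`transferSylow_eq_pow`); composing with `P ≃* Multiplicative (ZMod 2ᵏ)` gives **`exists_cyclicCharacter_of_isCyclic_sylow`**:
  `∃ w : G → ZMod (2^k)`, additive, `w c ≠ 0`, onto, odd kernel `∋ n₀ ≠ 1`.
* §2 **THE LAW, datum-free** (**`isLeast_card_gfaces_generate_fibreTwo_of_isCyclic_sylow`**, `…_card_block`): for every finite `G` whose Sylow
  `2`-subgroup is cyclic of order `≥ 4` and different from `G`, and every central involution `c ≠ 1`:
  **`μ(G, c) = φ₂(G, c) = β(G, c) − 1`**.  Element form (**`…_of_orderOf_eq_two_pow`**): `|G| = 2ᵏ·m`, `m > 1` odd, `k ≥ 2`, and SOME element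
  has order `2ᵏ`.
All [folklore] bookkeeping over [Pohlmann1968, Thm 1] in the reading of [Milne1999, Prop. 2.1].

## References
* [Pohlmann1968] H. Pohlmann, Algebraic cycles on abelian varieties of complex multiplication type, Ann. of Math. 88 (1968), Thm 1.
* [Milne1999] J. S. Milne, Lefschetz motives and the Tate conjecture, Compositio Math. 117 (1999), Prop. 2.1, p. 54.
-/

namespace Summit.HodgeConjecture.CorCM.Census.SylowTransfer

open Finset
open Summit.HodgeConjecture.CorCM.Prior.AllgGroup.RfwfAllgGroup
open Summit.HodgeConjecture.CorCM.Census.BlockParity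
open Summit.HodgeConjecture.CorCM.Census.Coinvariant

noncomputable section

variable {G : Type*} [Group G] [Fintype G] [DecidableEq G] (c : G)

/-! ## §1 Burnside: the cyclic character of a cyclic Sylow `2`-subgroup -/

omit [Fintype G] [DecidableEq G] in
/-- A group containing an involution `≠ 1` has even order, so its smallest prime factor is `2`. [folklore] -/
theorem minFac_card_eq_two (hc2 : c * c = 1) (hc1 : c ≠ 1) : (Nat.card G).minFac = 2 := by
  rw [Nat.minFac_eq_two_iff]
  have hord : orderOf c = 2 := orderOf_eq_prime (by rw [pow_two, hc2]) hc1
  exact hord ▸ orderOf_dvd_natCard c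

omit [DecidableEq G] in
/-- **THE CYCLIC CHARACTER OF A CYCLIC SYLOW `2`-SUBGROUP** (Burnside transfer): if a Sylow `2`-subgroup `P` of `G` is cyclic of order `2ᵏ`
and `P ≠ G`, then for every central `c ∈ G` with `c² = 1`, `c ≠ 1` there is an additive `w : G → ℤ/2ᵏ` with `w c ≠ 0`, taking the value `1`,
whose kernel consists of odd-order elements and contains some `n₀ ≠ 1`. [folklore] -/
theorem exists_cyclicCharacter_of_isCyclic_sylow (P : Sylow 2 G) (hP : IsCyclic (P : Subgroup G)) {k : ℕ}
    (hk : Nat.card (P : Subgroup G) = 2 ^ k) (hidx : (P : Subgroup G).index ≠ 1) (hc2 : c * c = 1) (hc1 : c ≠ 1)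
    (hcen : ∀ x : G, x * c = c * x) :
    ∃ w : G → ZMod (2 ^ k), (∀ x y : G, w (x * y) = w x + w y) ∧ w c ≠ 0 ∧ (∃ g₁ : G, w g₁ = 1) ∧
      (∀ g : G, w g = 0 → Odd (orderOf g)) ∧ ∃ n₀ : G, w n₀ = 0 ∧ n₀ ≠ 1 := by
  have hN := IsCyclic.normalizer_le_centralizer (minFac_card_eq_two c hc2 hc1) hP
  set V := MonoidHom.transferSylow P hN with hV
  have hcP : c ∈ (P : Subgroup G) := TypeStabiliser.mem_sylow_of_central c hc2 hcen P
  haveI : IsCyclic (P : Subgroup G) := hP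
  have hcard : Nat.card (P : Subgroup G) = Nat.card (Multiplicative (ZMod (2 ^ k))) := by
    rw [hk, Nat.card_eq_fintype_card, Fintype.card_multiplicative, ZMod.card]
  set e : (P : Subgroup G) ≃* Multiplicative (ZMod (2 ^ k)) := mulEquivOfCyclicCardEq hcard with he
  refine ⟨fun g => Multiplicative.toAdd (e (V g)), fun x y => by simp only [map_mul, toAdd_mul], ?_, ?_, ?_, ?_⟩
  · -- `w c ≠ 0`: `V c = c ^ [G:P] = c`
    have hVc : V c = ⟨c, hcP⟩ := by
      rw [hV, MonoidHom.transferSylow_eq_pow P hN c hcP]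
      obtain ⟨m, hm⟩ := odd_index_sylow' P
      refine Subtype.ext ?_
      simp only
      rw [hm, pow_succ, pow_mul, pow_two, hc2, one_pow, one_mul]
    intro h0
    change Multiplicative.toAdd (e (V c)) = 0 at h0
    rw [hVc, toAdd_eq_zero, EmbeddingLike.map_eq_one_iff] at h0
    exact hc1 (congrArg Subtype.val h0)
  · -- onto: `V|_P` is the bijection `g ↦ g ^ [G:P]`
    haveI : Fact (Nat.Prime 2) := ⟨Nat.prime_two⟩
    have hbij : Function.Bijective ((MonoidHom.transferSylow P hN).restrict (P : Subgroup G)) :=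
      (MonoidHom.transferSylow_restrict_eq_pow P hN).symm ▸ (P.2.powEquiv' P.not_dvd_index).bijective
    obtain ⟨x, hx⟩ := hbij.2 (e.symm (Multiplicative.ofAdd 1))
    refine ⟨x, ?_⟩
    rw [MonoidHom.restrict_apply, ← hV] at hx
    change Multiplicative.toAdd (e (V x)) = 1
    simp only [hx, MulEquiv.apply_symm_apply, toAdd_ofAdd]
  · -- odd kernel
    haveI : Fact (Nat.Prime 2) := ⟨Nat.prime_two⟩
    intro g hg
    change Multiplicative.toAdd (e (V g)) = 0 at hg
    rw [toAdd_eq_zero, EmbeddingLike.map_eq_one_iff] at hg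
    have hmem : g ∈ V.ker := hg
    have hodd : ¬ 2 ∣ Nat.card V.ker := MonoidHom.not_dvd_card_ker_transferSylow P hN
    exact Nat.odd_iff.mpr (Nat.two_dvd_ne_zero.mp fun h => hodd (h.trans (V.ker.orderOf_dvd_natCard hmem)))
  · -- non-trivial kernel: `|ker V| = [G:P] > 1`
    haveI : Fact (Nat.Prime 2) := ⟨Nat.prime_two⟩
    have hcardK : Nat.card V.ker = (P : Subgroup G).index := ((MonoidHom.ker_transferSylow_isComplement' P hN).index_eq_card).symm
    have hne : V.ker ≠ ⊥ := by
      rw [← Subgroup.one_lt_card_iff_ne_bot, hcardK]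
      have := (P : Subgroup G).index_ne_zero_of_finite
      omega
    obtain ⟨⟨n₀, hn₀⟩, hn₀1⟩ := Subgroup.ne_bot_iff_exists_ne_one.mp hne
    refine ⟨n₀, ?_, fun h => hn₀1 (Subtype.ext h)⟩
    have : V n₀ = 1 := hn₀
    change Multiplicative.toAdd (e (V n₀)) = 0
    simp only [this, map_one, toAdd_one]
where
  /-- The index of a Sylow `2`-subgroup is odd. [folklore] -/
  odd_index_sylow' (P : Sylow 2 G) : Odd (P : Subgroup G).index := by
    haveI : Fact (Nat.Prime 2) := ⟨Nat.prime_two⟩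
    exact Nat.odd_iff.mpr (Nat.two_dvd_ne_zero.mp P.not_dvd_index)

/-! ## §2 The law, datum-free -/

/-- **CYCLIC SYLOW `2`-SUBGROUP ⟹ `μ(G, c) = φ₂(G, c)` and `φ₂ + 1 = β`**: for every finite group whose Sylow `2`-subgroup is cyclic of order
`≥ 4` and proper, and every central involution `c ≠ 1` (seat b09's CYCLIC-SYLOW LAW, datum discharged by Burnside transfer). [folklore] -/
theorem isLeast_card_gfaces_generate_fibreTwo_of_isCyclic_sylow (P : Sylow 2 G) (hP : IsCyclic (P : Subgroup G))
    (h4 : 4 ≤ Nat.card (P : Subgroup G)) (hidx : (P : Subgroup G).index ≠ 1) (hc2 : c * c = 1) (hc1 : c ≠ 1)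
    (hcen : ∀ x : G, x * c = c * x) :
    IsLeast {n : ℕ | ∃ S : Finset (CMF G c →₀ ℤ), (↑S ⊆ gfaceSet G c hc2) ∧ S.card = n ∧
      hodgeSpan c hc2 ≤ Submodule.span ℤ (pairSet c) ⊔ Submodule.span ℤ (translates c S)} (fibreTwo c hc2) ∧
    fibreTwo c hc2 + 1 = Fintype.card (Block c) := by
  haveI : Fact (Nat.Prime 2) := ⟨Nat.prime_two⟩
  obtain ⟨k, hk⟩ := P.2.exists_card_eq
  have hk2 : 2 ≤ k := by
    by_contra h
    interval_cases k <;> simp [hk] at h4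
  obtain ⟨w, hw, hwc, h1, hodd, n₀, hn₀, hn₀1⟩ := exists_cyclicCharacter_of_isCyclic_sylow c P hP hk hidx hc2 hc1 hcen
  haveI : Fintype (CMF G c) := Fintype.ofFinite _
  exact CyclicCharacter.isLeast_card_gfaces_generate_of_cyclic hw (by omega) hk2 hc2 hcen hwc h1 hodd hn₀ hn₀1

/-- Block currency: **cyclic Sylow `2`-subgroup ⟹ `μ(G, c) = β(G, c) − 1`.** [folklore] -/
theorem isLeast_card_gfaces_generate_of_isCyclic_sylow_card_block (P : Sylow 2 G) (hP : IsCyclic (P : Subgroup G))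
    (h4 : 4 ≤ Nat.card (P : Subgroup G)) (hidx : (P : Subgroup G).index ≠ 1) (hc2 : c * c = 1) (hc1 : c ≠ 1)
    (hcen : ∀ x : G, x * c = c * x) :
    IsLeast {n : ℕ | ∃ S : Finset (CMF G c →₀ ℤ), (↑S ⊆ gfaceSet G c hc2) ∧ S.card = n ∧
      hodgeSpan c hc2 ≤ Submodule.span ℤ (pairSet c) ⊔ Submodule.span ℤ (translates c S)} (Fintype.card (Block c) - 1) := by
  obtain ⟨h, hβ⟩ := isLeast_card_gfaces_generate_fibreTwo_of_isCyclic_sylow c P hP h4 hidx hc2 hc1 hcen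
  rw [← hβ, Nat.add_sub_cancel]
  exact h

/-- **Element form**: if `|G| = 2ᵏ·m` with `m > 1` odd, `k ≥ 2`, and some `u ∈ G` has order `2ᵏ`, then `⟨u⟩` is a cyclic Sylow `2`-subgroup and
`μ(G, c) = φ₂(G, c) = β(G, c) − 1` for every central involution `c ≠ 1`. [folklore] -/
theorem isLeast_card_gfaces_generate_fibreTwo_of_orderOf_eq_two_pow {k m : ℕ} (u : G) (hu : orderOf u = 2 ^ k) (hk : 2 ≤ k)
    (hG : Fintype.card G = 2 ^ k * m) (hm : Odd m) (hm1 : m ≠ 1) (hc2 : c * c = 1) (hc1 : c ≠ 1) (hcen : ∀ x : G, x * c = c * x) :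
    IsLeast {n : ℕ | ∃ S : Finset (CMF G c →₀ ℤ), (↑S ⊆ gfaceSet G c hc2) ∧ S.card = n ∧
      hodgeSpan c hc2 ≤ Submodule.span ℤ (pairSet c) ⊔ Submodule.span ℤ (translates c S)} (fibreTwo c hc2) ∧
    fibreTwo c hc2 + 1 = Fintype.card (Block c) := by
  haveI : Fact (Nat.Prime 2) := ⟨Nat.prime_two⟩
  have hcardU : Nat.card (Subgroup.zpowers u) = 2 ^ k := by rw [Nat.card_zpowers, hu]
  have hidxU : (Subgroup.zpowers u).index = m := by
    have h := (Subgroup.zpowers u).card_mul_index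
    rw [hcardU, Nat.card_eq_fintype_card, hG] at h
    exact Nat.eq_of_mul_eq_mul_left (by positivity) h
  have hPG : IsPGroup 2 (Subgroup.zpowers u) := IsPGroup.of_card hcardU
  set P : Sylow 2 G := hPG.toSylow (by rw [hidxU]; exact hm.not_two_dvd_nat) with hP
  have hPu : (P : Subgroup G) = Subgroup.zpowers u := rfl
  have hcyc : IsCyclic (P : Subgroup G) := by rw [hPu]; exact Subgroup.isCyclic_zpowers u  -- `⟨u⟩` is cyclic
  refine isLeast_card_gfaces_generate_fibreTwo_of_isCyclic_sylow c P hcyc ?_ ?_ hc2 hc1 hcen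
  · rw [hPu, hcardU]
    calc 4 = 2 ^ 2 := by norm_num
      _ ≤ 2 ^ k := Nat.pow_le_pow_right (by norm_num) hk
  · rw [hPu, hidxU]
    exact hm1

end

end Summit.HodgeConjecture.CorCM.Census.SylowTransfer
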